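import Mathlib.Analysis.SpecialFunctions.Trigonometric.ArctanDeriv
import Literature.NumberTheory.Transcendental.KZDilationLogGenerators
import HarnessLib

/-!
# The arctangent sector of the Kontsevich–Zagier dilation pencil: the lift

Setting of `KZDilationLogSector.lean` / `KZDilationLogSectorLift.lean` (`(a, b) ⊇ [0,1]`, dilation
functions `v_h(ϖ) = ∫_{[0,1]¹} h(ϖz) dz`, twisted-diagonal Nash kernels `K (vecCons ϖ (ϖ • y))`).
**Theorem** (`KZ.dilationArctanSector_lift`): for `T` Nash (`ℚ`-semialgebraic and real-analytic) on
`(a, b)` with `T(0) = T(1) = 0` and `h := (arctan ∘ T)' = T'/(1 + T²)` — so that the cube period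
`∫₀¹ h = arctan T(1) − arctan T(0)` vanishes — the dilation function factors on ALL of `[0,1]`:
  `v_h(ϖ) = arctan(T(ϖ))/ϖ = (ϖ − 1) · ∫_{[0,1]¹} K(ϖ, ϖ y) dy`,
  `K(p₀, p₁) := τ(p₀) / (1 + (τ(p₀)(p₀ − 1) p₁)²)`,  `T = ϖ(ϖ − 1)τ`
(`σ := dslope T 0`, `τ := dslope σ 1`, both Nash), using `∫₀¹ db/(1 + c²b²) = arctan(c)/c`.
Unlike the logarithmic sector no division trick is needed: the kernel is regular on the whole
strip `(a,b) × ℝ`. This is the functional half of the lift of vanishing combinations of ARGUMENTS of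
algebraic functions (imaginary parts of logarithms — complex poles of rational integrands) in the
dimension-one dilation lifting problem of route `KontsevichZagierPeriods/LiftingCriteria`
(crux `DilationLiftAtOne`); the arithmetic half is Baker's theorem.

Everything is proved; no `def`, no named fact.

## References
* M. Kontsevich, D. Zagier, *Periods* (2001), §1.2. [`KontsevichZagier2001`]
* J. Bochnak, M. Coste, M.-F. Roy, *Real Algebraic Geometry* (1998), Prop. 2.2.6. [`BochnakCosteRoy1998`]
-/

noncomputable section

open Set MeasureTheory Filter MvPolynomial
open scoped BigOperators Topology
open Literature.ModelTheory.ExponentialFields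

namespace Literature.NumberTheory.Transcendental

namespace KZ.DilationArctanSector

/-! ### The integral `∫₀¹ db/(1 + c²b²) = arctan(c)/c` -/

/-- `∫₀¹ db/(1 + (cb)²) = arctan(c)/c` for `c ≠ 0` (primitive `arctan(cb)/c`). [folklore] -/
theorem integral_inv_one_add_sq_mul {c : ℝ} (hc : c ≠ 0) :
    (∫ t in (0:ℝ)..1, (1 + (c * t) ^ 2)⁻¹) = Real.arctan c / c := by
  have hderiv : ∀ t ∈ uIcc (0:ℝ) 1,
      HasDerivAt (fun t => Real.arctan (c * t) / c) ((1 + (c * t) ^ 2)⁻¹) t := by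
    intro t _
    have h1 : HasDerivAt (fun t => c * t) c t := by simpa using (hasDerivAt_id t).const_mul c
    have h2 := (h1.arctan).div_const c
    have h3 : 1 / (1 + (c * t) ^ 2) * c / c = (1 + (c * t) ^ 2)⁻¹ := by
      rw [mul_div_assoc, div_self hc, mul_one, one_div]
    rw [h3] at h2
    exact h2
  rw [intervalIntegral.integral_eq_sub_of_hasDerivAt hderiv]
  · simp
  · apply Continuous.intervalIntegrable
    exact Continuous.inv₀ (by fun_prop) (fun t => by positivity)

/-- `∫_{[0,1]} db/(1 + (cb)²)` as a set integral, with the value `1` at `c = 0`. [folklore] -/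
theorem setIntegral_inv_one_add_sq_mul (c : ℝ) :
    (∫ t in Icc (0:ℝ) 1, (1 + (c * t) ^ 2)⁻¹) = if c = 0 then 1 else Real.arctan c / c := by
  rw [integral_Icc_eq_integral_Ioc, ← intervalIntegral.integral_of_le zero_le_one]
  split_ifs with hc
  · subst hc; simp
  · exact integral_inv_one_add_sq_mul hc

/-! ### The kernel `K(p) = τ(p₀)/(1 + (τ(p₀)(p₀ − 1)p₁)²)` on the strip `{p | p₀ ∈ (a,b)}` -/

section Kernel

variable {a b : ℝ} {τ : ℝ → ℝ}

/-- The strip `{p | p₀ ∈ (a,b)} ⊆ ℝ²` is open. [folklore] -/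
theorem isOpen_strip : IsOpen {p : Fin 2 → ℝ | p 0 ∈ Ioo a b} :=
  isOpen_Ioo.preimage (continuous_apply 0)

/-- The kernel is `ℚ`-semialgebraic on the strip when `τ` is (composition with the coordinate
projection, products, and the inverse of `1 + (…)²`). [cite: BochnakCosteRoy1998, Prop. 2.2.6] -/
theorem isSemialgebraicFunOn_kernel
    (hτ : IsSemialgebraicFunOn ℚ {t : Fin 1 → ℝ | t 0 ∈ Ioo a b} (fun t => τ (t 0))) :
    IsSemialgebraicFunOn ℚ {p : Fin 2 → ℝ | p 0 ∈ Ioo a b}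
      (fun p => τ (p 0) * (1 + (τ (p 0) * (p 0 - 1) * p 1) ^ 2)⁻¹) := by
  have hI : IsSemialgebraic ℚ {t : Fin 1 → ℝ | t 0 ∈ Ioo a b} :=
    IsSemialgebraicFunOn.isSemialgebraic_holds hτ
  have hV0 : IsSemialgebraic ℚ {p : Fin 2 → ℝ | p 0 ∈ Ioo a b} := by
    simpa using hI.preimage_comp (fun _ : Fin 1 => (0 : Fin 2))
  set V : Set (Fin 2 → ℝ) := {p : Fin 2 → ℝ | p 0 ∈ Ioo a b} with hV_def
  have hV : IsSemialgebraic ℚ V := hV0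
  have hproj : IsSemialgebraicMapOn ℚ V (fun p : Fin 2 → ℝ => fun _ : Fin 1 => p 0) :=
    IsSemialgebraicMapOn.of_forall hV fun _ => by
      simpa using isSemialgebraicFunOn_aeval hV (X 0 : MvPolynomial (Fin 2) ℚ)
  have hmaps : MapsTo (fun p : Fin 2 → ℝ => fun _ : Fin 1 => p 0) V
      {t : Fin 1 → ℝ | t 0 ∈ Ioo a b} := fun p hp => hp
  have hτV : IsSemialgebraicFunOn ℚ V (fun p => τ (p 0)) :=
    (IsSemialgebraicFunOn.comp_isSemialgebraicMapOn_holds hτ hproj hmaps).congr fun _ _ => rfl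
  have h0 : IsSemialgebraicFunOn ℚ V (fun p : Fin 2 → ℝ => p 0 - 1) :=
    (isSemialgebraicFunOn_aeval hV (X 0 - 1 : MvPolynomial (Fin 2) ℚ)).congr fun p _ => by simp
  have h1 : IsSemialgebraicFunOn ℚ V (fun p : Fin 2 → ℝ => p 1) := by
    simpa using isSemialgebraicFunOn_aeval hV (X 1 : MvPolynomial (Fin 2) ℚ)
  have hm : IsSemialgebraicFunOn ℚ V (fun p => τ (p 0) * (p 0 - 1) * p 1) := (hτV.fun_mul h0).fun_mul h1
  have hden : IsSemialgebraicFunOn ℚ V (fun p => 1 + (τ (p 0) * (p 0 - 1) * p 1) ^ 2) :=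
    ((isSemialgebraicFunOn_const_natCast hV 1).fun_add (hm.fun_mul hm)).congr fun _ _ => by
      push_cast; ring
  exact hτV.fun_mul hden.fun_inv

/-- The kernel is real-analytic on the strip when `τ` is real-analytic on `(a,b)` (the denominator
is `≥ 1`). [folklore] -/
theorem analyticOnNhd_kernel (hτa : ∀ x ∈ Ioo a b, AnalyticAt ℝ τ x) :
    AnalyticOnNhd ℝ (fun p : Fin 2 → ℝ => τ (p 0) * (1 + (τ (p 0) * (p 0 - 1) * p 1) ^ 2)⁻¹)
      {p : Fin 2 → ℝ | p 0 ∈ Ioo a b} := by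
  intro p hp
  have h0 : AnalyticAt ℝ (fun p : Fin 2 → ℝ => p 0) p :=
    (ContinuousLinearMap.proj (R := ℝ) (φ := fun _ : Fin 2 => ℝ) 0).analyticAt p
  have h1 : AnalyticAt ℝ (fun p : Fin 2 → ℝ => p 1) p :=
    (ContinuousLinearMap.proj (R := ℝ) (φ := fun _ : Fin 2 => ℝ) 1).analyticAt p
  have hτp : AnalyticAt ℝ (fun p : Fin 2 → ℝ => τ (p 0)) p :=
    AnalyticAt.comp (f := fun q : Fin 2 → ℝ => q 0) (hτa (p 0) hp) h0
  have hm : AnalyticAt ℝ (fun p : Fin 2 → ℝ => τ (p 0) * (p 0 - 1) * p 1) p :=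
    (hτp.mul (h0.sub analyticAt_const)).mul h1
  have hpos : 1 + (τ (p 0) * (p 0 - 1) * p 1) ^ 2 ≠ 0 := by positivity
  exact hτp.mul ((analyticAt_const.add (hm.pow 2)).inv hpos)

/-- **The kernel integral.** `∫_{[0,1]¹} K(ϖ, ϖy) dy = τ(ϖ) · J(τ(ϖ)(ϖ−1)ϖ)` with
`J(c) = ∫₀¹ db/(1 + (cb)²)`. [folklore] -/
theorem setIntegral_kernel (ϖ : ℝ) :
    (∫ y in Set.pi Set.univ (fun _ : Fin 1 => Icc (0:ℝ) 1),
        (fun p : Fin 2 → ℝ => τ (p 0) * (1 + (τ (p 0) * (p 0 - 1) * p 1) ^ 2)⁻¹)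
          (Matrix.vecCons ϖ (ϖ • y))) =
      τ ϖ * (if τ ϖ * (ϖ - 1) * ϖ = 0 then 1
        else Real.arctan (τ ϖ * (ϖ - 1) * ϖ) / (τ ϖ * (ϖ - 1) * ϖ)) := by
  have key : (∫ y in Set.pi Set.univ (fun _ : Fin 1 => Icc (0:ℝ) 1),
      (fun p : Fin 2 → ℝ => τ (p 0) * (1 + (τ (p 0) * (p 0 - 1) * p 1) ^ 2)⁻¹)
        (Matrix.vecCons ϖ (ϖ • y))) =
      ∫ t in Icc (0:ℝ) 1, τ ϖ * (1 + ((τ ϖ * (ϖ - 1) * ϖ) * t) ^ 2)⁻¹ := by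
    have hfun : ∀ y : Fin 1 → ℝ,
        (fun p : Fin 2 → ℝ => τ (p 0) * (1 + (τ (p 0) * (p 0 - 1) * p 1) ^ 2)⁻¹)
            (Matrix.vecCons ϖ (ϖ • y)) =
          τ ϖ * (1 + ((τ ϖ * (ϖ - 1) * ϖ) * y 0) ^ 2)⁻¹ := by
      intro y
      simp only [Matrix.cons_val_zero, Matrix.cons_val_one, Pi.smul_apply, smul_eq_mul]
      ring_nf
    simp_rw [hfun]
    exact KZ.DilationLogSector.setIntegral_cube_one (fun t => τ ϖ * (1 + ((τ ϖ * (ϖ - 1) * ϖ) * t) ^ 2)⁻¹)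
  rw [key, integral_const_mul, setIntegral_inv_one_add_sq_mul]

end Kernel

end KZ.DilationArctanSector

namespace KZ

open DilationArctanSector

/-! ### The lift -/

/-- **The arctangent sector of the glue (`stub_glueAtOne` / crux `DilationLiftAtOne`, single
generator, dimension one) holds unconditionally.** Let `T` be Nash (`ℚ`-semialgebraic and
real-analytic) on an open interval `(a, b) ⊇ [0,1]` with `T(0) = T(1) = 0`, and
`h := (arctan ∘ T)' = T'/(1 + T²)` (so the period `∫₀¹ h = 0`). Then the dilation function
`v_h(ϖ) = ∫_{[0,1]¹} h(ϖ z) dz` factors on ALL of `[0,1]` as `(ϖ − 1) · ∫_{[0,1]¹} K(ϖ, ϖ y) dy` with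
ONE kernel Nash on the open strip `(a,b) × ℝ ⊇ [0,1] × [0,1]`:
`K(p) = τ(p₀)/(1 + (τ(p₀)(p₀−1)p₁)²)`, `σ = dslope T 0`, `τ = dslope σ 1` (`T = ϖ(ϖ−1)τ`), by
`∫₀¹ db/(1 + (cb)²) = arctan(c)/c`. [cite: KontsevichZagier2001, §1.2] -/
theorem dilationArctanSector_lift {a b : ℝ} (ha : a < 0) (hb : 1 < b) {T : ℝ → ℝ}
    (hTs : IsSemialgebraicFunOn ℚ {t : Fin 1 → ℝ | t 0 ∈ Ioo a b} (fun t => T (t 0)))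
    (hTa : ∀ x ∈ Ioo a b, AnalyticAt ℝ T x) (hT0 : T 0 = 0) (hT1 : T 1 = 0) :
    ∃ (K : (Fin 2 → ℝ) → ℝ) (V : Set (Fin 2 → ℝ)), IsOpen V ∧
      (∀ ϖ ∈ Icc (0:ℝ) 1, ∀ x ∈ Set.pi Set.univ (fun _ : Fin 1 => Icc (0:ℝ) 1),
        Matrix.vecCons ϖ x ∈ V) ∧
      IsSemialgebraicFunOn ℚ V K ∧ AnalyticOnNhd ℝ K V ∧
      ∀ ϖ ∈ Icc (0:ℝ) 1,
        (∫ z in Set.pi Set.univ (fun _ : Fin 1 => Icc (0:ℝ) 1),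
            deriv T ((ϖ • z) 0) / (1 + T ((ϖ • z) 0) ^ 2)) =
          (ϖ - 1) * ∫ y in Set.pi Set.univ (fun _ : Fin 1 => Icc (0:ℝ) 1),
            K (Matrix.vecCons ϖ (ϖ • y)) := by
  have hb0 : (0:ℝ) < b := zero_lt_one.trans hb
  have h0I : (0:ℝ) ∈ Ioo a b := ⟨ha, hb0⟩
  have h1I : (1:ℝ) ∈ Ioo a b := ⟨ha.trans zero_lt_one, hb⟩
  have hsub : Icc (0:ℝ) 1 ⊆ Ioo a b := fun x hx => ⟨ha.trans_le hx.1, hx.2.trans_lt hb⟩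
  -- the primitive `arctan ∘ T` of the integrand
  have hTd : ∀ x ∈ Ioo a b, HasDerivAt T (deriv T x) x := fun x hx =>
    (hTa x hx).differentiableAt.hasDerivAt
  have hPd : ∀ x ∈ Ioo a b, HasDerivAt (fun x => Real.arctan (T x))
      (deriv T x / (1 + T x ^ 2)) x := fun x hx => by
    have h := (hTd x hx).arctan
    convert h using 1
    ring
  have hgc : ContinuousOn (fun x => deriv T x / (1 + T x ^ 2)) (Ioo a b) := by
    intro x hx
    have h1 : ContinuousAt (deriv T) x := (hTa x hx).deriv.continuousAt
    have h2 : ContinuousAt (fun x => 1 + T x ^ 2) x :=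
      continuousAt_const.add ((hTa x hx).continuousAt.pow 2)
    exact (h1.div h2 (by positivity)).continuousWithinAt
  -- `σ := dslope T 0`, `τ := dslope σ 1`
  set σ : ℝ → ℝ := dslope T 0 with hσ_def
  set τ : ℝ → ℝ := dslope σ 1 with hτ_def
  have hσs : IsSemialgebraicFunOn ℚ {t : Fin 1 → ℝ | t 0 ∈ Ioo a b} (fun t => σ (t 0)) := by
    have h := IsSemialgebraicFunOn.dslope_ratCast (f' := deriv T) 0 (by simpa using h0I) hTs hTd
    simpa using h
  have hσa : ∀ x ∈ Ioo a b, AnalyticAt ℝ σ x := fun x hx =>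
    analyticAt_dslope_of_analyticAt (hTa 0 h0I) (hTa x hx)
  have hτs : IsSemialgebraicFunOn ℚ {t : Fin 1 → ℝ | t 0 ∈ Ioo a b} (fun t => τ (t 0)) := by
    have h := IsSemialgebraicFunOn.dslope_ratCast (f' := deriv σ) 1 (by simpa using h1I) hσs
      (fun x hx => (hσa x hx).differentiableAt.hasDerivAt)
    simpa using h
  have hτa : ∀ x ∈ Ioo a b, AnalyticAt ℝ τ x := fun x hx =>
    analyticAt_dslope_of_analyticAt (hσa 1 h1I) (hσa x hx)
  have hσT : ∀ ϖ, T ϖ = ϖ * σ ϖ := fun ϖ => by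
    have h := sub_smul_dslope T 0 ϖ
    rw [sub_zero, smul_eq_mul, hT0, sub_zero] at h
    exact h.symm
  have hσ1 : σ 1 = 0 := by
    have h := hσT 1
    rw [hT1, one_mul] at h
    exact h.symm
  have hτσ : ∀ ϖ, σ ϖ = (ϖ - 1) * τ ϖ := fun ϖ => by
    have h := sub_smul_dslope σ 1 ϖ
    rw [hσ1, sub_zero, smul_eq_mul] at h
    exact h.symm
  have hT : ∀ ϖ, T ϖ = τ ϖ * (ϖ - 1) * ϖ := fun ϖ => by rw [hσT ϖ, hτσ ϖ]; ring
  have hσ0 : σ 0 = deriv T 0 := by rw [hσ_def, dslope_same]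
  -- the kernel
  refine ⟨fun p => τ (p 0) * (1 + (τ (p 0) * (p 0 - 1) * p 1) ^ 2)⁻¹,
    {p : Fin 2 → ℝ | p 0 ∈ Ioo a b}, isOpen_strip, ?_, isSemialgebraicFunOn_kernel hτs,
    analyticOnNhd_kernel hτa, ?_⟩
  · intro ϖ hϖ x _
    simpa using hsub hϖ
  · intro ϖ hϖ
    rw [setIntegral_kernel ϖ]
    rcases hϖ.1.eq_or_lt with h0 | hpos
    · -- `ϖ = 0`: both sides equal `T'(0) = σ(0)`
      subst h0
      rw [KZ.DilationLogSector.dilation_integral_zero (h := fun x => deriv T x / (1 + T x ^ 2)), hT0]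
      have : τ 0 = -σ 0 := by have h := hτσ 0; linarith
      simp [this, hσ0]
    · rw [KZ.DilationLogSector.dilation_integral_of_hasDerivAt ha hb hPd hgc ⟨hpos, hϖ.2⟩, hT0,
        Real.arctan_zero, sub_zero, ← hT ϖ]
      by_cases hTϖ : T ϖ = 0
      · -- `T ϖ = 0`: both sides vanish (`τ ϖ (ϖ - 1) = T ϖ/ϖ = 0`)
        have hτ0 : (ϖ - 1) * τ ϖ = 0 := by
          have h := hT ϖ
          rw [hTϖ] at h
          have : τ ϖ * (ϖ - 1) * ϖ = 0 := h.symm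
          rcases mul_eq_zero.mp this with h' | h'
          · linarith [h']
          · exact absurd h' hpos.ne'
        rw [hTϖ, if_pos rfl, Real.arctan_zero, zero_div, mul_one]
        exact hτ0.symm
      · rw [if_neg hTϖ]
        have hϖ0 : ϖ ≠ 0 := hpos.ne'
        have hprod : τ ϖ * (ϖ - 1) * ϖ ≠ 0 := by rwa [← hT ϖ]
        have hne1 : τ ϖ ≠ 0 := fun h => hprod (by rw [h]; ring)
        have hne2 : ϖ - 1 ≠ 0 := fun h => hprod (by rw [h]; ring)
        rw [hT ϖ]
        field_simp

end KZ

end Literature.NumberTheory.Transcendental
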